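import Literature.MathematicalPhysics.QuantumLattice.GrassmannIntegrationByParts
import Literature.MathematicalPhysics.QuantumLattice.GrassmannKernelsGenProd
import Literature.MathematicalPhysics.QuantumLattice.GrassmannLaplacianPairWick
import HarnessLib

/-!
# The Gaussian convolution of cubic and quartic monomials (Wick's rule with all terms, not only the expectation)

Topic `MathematicalPhysics/QuantumLattice`; generic layer over `GrassmannIntegrationByParts.gaussConv_gen_mul` (the integration-by-parts
/ Wick recursion `μ_C ⋆ (ψ(X) a) = ψ(X) (μ_C ⋆ a) + Σ_Y A(X,Y) ∂_Y (μ_C ⋆ a)`, `A(X,Y) = ½(C(Y,X) - C(X,Y)) = contr C X Y`).  Iterating it,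

* `gaussConv_gen_mul_gen_mul_gen` — `μ ⋆ (ψ_b ψ_c ψ_d) = ψ_bψ_cψ_d + A(c,d)ψ_b - A(b,d)ψ_c + A(b,c)ψ_d`;
* **`gaussConv_gen_four`** — `μ ⋆ (ψ_aψ_bψ_cψ_d) = ψ_aψ_bψ_cψ_d + A(c,d)ψ_aψ_b - A(b,d)ψ_aψ_c + A(b,c)ψ_aψ_d + A(a,b)ψ_cψ_d
  - A(a,c)ψ_bψ_d + A(a,d)ψ_bψ_c + (A(a,b)A(c,d) - A(a,c)A(b,d) + A(a,d)A(b,c))` (the Pfaffian);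
* `kernel_algebraMap_succ` — constants have no kernels in positive degree.

This is the exact "linear part" of one renormalisation-group step on a local quartic plus quadratic action: the tracked part of
`GrassmannFlowIterationSplit`/`GrassmannFlowDB` flows by tadpoles (Benfatto–Giuliani–Mastropietro 2006, (2.86)–(2.88); Salmhofer 1999,
§4.3, Wick ordering).  Everything is proved; no definitions, no named facts.

## Sources

M. Salmhofer, *Renormalization* (1999), §4.3 (4.38)–(4.44) (`Salmhofer1999`); G. Benfatto, A. Giuliani, V. Mastropietro,
Ann. Henri Poincaré 7 (2006) 809–898, (2.86)–(2.88) (`BenfattoGiulianiMastropietro2006`).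
-/

noncomputable section

namespace Literature.MathematicalPhysics.QuantumLattice

open GrassmannAlgebra Finset

variable (R : Type*) [CommRing R] [Algebra ℚ R] {Γ : Type*} [DecidableEq Γ]

/-- **Constants have no kernels in positive degree.** [cite: Salmhofer1999, §4.3 (4.95)] -/
theorem kernel_algebraMap_succ (r : R) (m : ℕ) (X : Fin (m + 1) → Γ) :
    kernel R (algebraMap R (GrassmannAlgebra R Γ) r) (m + 1) X = 0 := by
  have h : algebraMap R (GrassmannAlgebra R Γ) r = r • genProd R (Fin.elim0 : Fin 0 → Γ) := by
    rw [genProd_zero, Algebra.algebraMap_eq_smul_one]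
  rw [h, kernel_smul, kernel_genProd_of_ne R X Fin.elim0 (Nat.succ_ne_zero m), mul_zero]

variable [Fintype Γ]

/-- **Wick's rule for a cubic monomial**: `μ_C ⋆ (ψ_b ψ_c ψ_d) = ψ_bψ_cψ_d + A(c,d)ψ_b - A(b,d)ψ_c + A(b,c)ψ_d`.
[cite: Salmhofer1999, §4.3 (4.44)] -/
theorem gaussConv_gen_mul_gen_mul_gen (C : Matrix Γ Γ R) (b c d : Γ) :
    gaussConv R C (gen R b * gen R c * gen R d) =
      gen R b * gen R c * gen R d + contr R C c d • gen R b - contr R C b d • gen R c + contr R C b c • gen R d := by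
  rw [mul_assoc, gaussConv_gen_mul, gaussConv_gen_mul_gen]
  simp only [← contr_apply]
  simp only [Algebra.algebraMap_eq_smul_one, map_add, map_smul, grassmannDeriv_gen_mul_gen, grassmannDeriv_one, smul_zero,
    add_zero]
  simp only [smul_sub, sum_sub_distrib, smul_ite, smul_zero, sum_ite_eq', mem_univ, if_true, mul_add, mul_smul_comm, mul_one]
  abel

/-- **Wick's rule for a quartic monomial** (all terms): `μ_C ⋆ (ψ_aψ_bψ_cψ_d)` equals the monomial, plus the six single
contractions, plus the Pfaffian `A(a,b)A(c,d) - A(a,c)A(b,d) + A(a,d)A(b,c)`. [cite: Salmhofer1999, §4.3 (4.44)] -/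
theorem gaussConv_gen_four (C : Matrix Γ Γ R) (a b c d : Γ) :
    gaussConv R C (gen R a * gen R b * gen R c * gen R d) =
      gen R a * gen R b * gen R c * gen R d +
        (contr R C c d • (gen R a * gen R b) - contr R C b d • (gen R a * gen R c) + contr R C b c • (gen R a * gen R d) +
          contr R C a b • (gen R c * gen R d) - contr R C a c • (gen R b * gen R d) + contr R C a d • (gen R b * gen R c)) +
        algebraMap R _ (contr R C a b * contr R C c d - contr R C a c * contr R C b d + contr R C a d * contr R C b c) := by
  rw [show gen R a * gen R b * gen R c * gen R d = gen R a * (gen R b * gen R c * gen R d) by simp only [mul_assoc],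
    gaussConv_gen_mul, gaussConv_gen_mul_gen_mul_gen]
  simp only [← contr_apply]
  simp only [Algebra.algebraMap_eq_smul_one, map_add, map_sub, map_smul, mul_assoc, grassmannDeriv_gen_mul,
    grassmannDeriv_gen, mul_sub, mul_ite, mul_zero, smul_ite, smul_zero]
  simp only [smul_add, smul_sub, sum_add_distrib, sum_sub_distrib, smul_ite, smul_zero, sum_ite_eq', mem_univ, if_true,
    mul_add, mul_sub, mul_smul_comm, mul_one, smul_smul]
  abel

end Literature.MathematicalPhysics.QuantumLattice

end
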